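import Summits.QuantumFields.QCD.Theorems.PauliWegnerSeaFMClosureUnquenchedSideWitnessC1Aux3

/-!
# Side witness, part 4: the row-scaled twisted side matrix is a polynomial matrix in the twist

Crux `FMClosureUnquenched` (stmt-QuantumFields-11512), line `von-mises-circles`, registered sub-goal
`c1_sideWitness : SideWitness`.

For a signed link-exponent field `a` on the torus `(ℤ/N)⁴` (`N ≥ 3`), a point `t` of the unit circle
and the diagonal twist `g_t = diag(t̄, t̄, t²) ∈ SU(3)`, consider the gauge field
`U_t(e) = g_t` if `a e = 1`, `g_t⁻¹` if `a e = -1`, `1` otherwise.  Scaling the rows of the side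
matrix `D_A ⊕ 1` of `wilsonD U_t m₀` by `t` (colours `0, 1`) and `t²` (colour `2`) on `A` gives the
polynomial matrix `FLOWMAT 0 + t FLOWMAT 1 + t² FLOWMAT 2 + t⁴ FLOWMAT 4`
(`rowScaled_sideMatrix_eq`, = registered `c1_sideWitness_aux4`).
-/

namespace Summit.QuantumFields.QCD.Theorems.VonMisesCirclesC1

open Matrix Literature.MathematicalPhysics.QuantumLattice Literature.Probability.LatticeModels
open Summit.QuantumFields.QCD.Theorems.VonMisesCircles Literature.MathematicalPhysics.QuantumFieldTheory
open scoped ComplexConjugate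

set_option quotPrecheck false in
set_option hygiene false in
/-- The unit step `±e_μ` of label `ℓ = (μ, b)` on the torus `(ℤ/N)⁴`. -/
local notation "STEP" ℓ:arg =>
  (if Prod.snd ℓ then -(Pi.single (Prod.fst ℓ) 1 : TorusSite 4 N) else Pi.single (Prod.fst ℓ) 1)

set_option quotPrecheck false in
/-- The chiral hopping projector of label `ℓ`: `½(1 + γ_μ)` backward, `½(1 - γ_μ)` forward. -/
local notation "PROJ" ℓ:arg =>
  (if Prod.snd ℓ then chiralProjPlus (Prod.fst ℓ) else chiralProjMinus (Prod.fst ℓ))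

set_option quotPrecheck false in
/-- Exponent of `t` in the row-scaled twisted hop of signed link exponent `n` seen by colour `c`. -/
local notation "EXPF" c:arg n:arg =>
  (if n = (1 : ℤ) then (if c = (2 : Fin 3) then (4 : ℕ) else 0)
    else if n = (-1 : ℤ) then (if c = (2 : Fin 3) then (0 : ℕ) else 2)
    else (if c = (2 : Fin 3) then (2 : ℕ) else 1))

set_option quotPrecheck false in
set_option hygiene false in
/-- The signed link exponent seen by the hop `x → x + STEP ℓ` for the exponent field `a`. -/
local notation "LEXP" a:arg x:arg ℓ:arg =>
  (if Prod.snd ℓ then -(a (x + STEP ℓ) (Prod.fst ℓ)) else a x (Prod.fst ℓ))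

set_option quotPrecheck false in
set_option hygiene false in
/-- The `t^k`-coefficient of the row-scaled twisted side matrix (flow matrix for `k = 0`). -/
local notation "FLOWMAT" A:arg a:arg m₀:arg k:arg =>
  (Matrix.of fun (p q : QIdx N) =>
    if p.1 ∈ A ∧ q.1 ∈ A then
      (if p = q ∧ (if p.2.1 = (2 : Fin 3) then (2 : ℕ) else 1) = k then (((m₀ : ℝ) + 4 : ℝ) : ℂ) else 0) -
        ∑ ℓ : Fin 4 × Bool, (if q.1 = p.1 + STEP ℓ ∧ p.2.1 = q.2.1 ∧ EXPF p.2.1 (LEXP a p.1 ℓ) = k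
          then (PROJ ℓ) p.2.2 q.2.2 else 0)
    else (if p = q ∧ k = (0 : ℕ) then (1 : ℂ) else 0))

/-! ## Scalar bookkeeping -/

/-- Collapsing the four coefficients of a monomial `t^n X`, `n ∈ {0, 1, 2, 4}`. -/
theorem texp_collapse (t X : ℂ) {n : ℕ} (hn : n = 0 ∨ n = 1 ∨ n = 2 ∨ n = 4) :
    (if n = 0 then X else 0) + t * (if n = 1 then X else 0) + t ^ 2 * (if n = 2 then X else 0) +
      t ^ 4 * (if n = 4 then X else 0) = t ^ n * X := by
  rcases hn with h | h | h | h <;> subst h <;> simp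

/-- The hop exponents take values in `{0, 1, 2, 4}`. -/
theorem expf_mem (c : Fin 3) (n : ℤ) :
    (EXPF c n) = 0 ∨ (EXPF c n) = 1 ∨ (EXPF c n) = 2 ∨ (EXPF c n) = 4 := by
  by_cases h1 : n = 1
  · by_cases hc : c = 2
    · simp [h1, hc]
    · simp [h1, hc]
  · by_cases h2 : n = -1
    · by_cases hc : c = 2
      · simp [h2, hc]
      · simp [h2, hc]
    · by_cases hc : c = 2
      · simp [h1, h2, hc]
      · simp [h1, h2, hc]

/-- Regrouping the four coefficient matrices entrywise. -/
theorem poly_regroup (t : ℂ) (D : ℕ → ℂ) (H : ℕ → Fin 4 × Bool → ℂ) :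
    (D 0 - ∑ ℓ : Fin 4 × Bool, H 0 ℓ) + t * (D 1 - ∑ ℓ : Fin 4 × Bool, H 1 ℓ) +
      t ^ 2 * (D 2 - ∑ ℓ : Fin 4 × Bool, H 2 ℓ) + t ^ 4 * (D 4 - ∑ ℓ : Fin 4 × Bool, H 4 ℓ) =
    (D 0 + t * D 1 + t ^ 2 * D 2 + t ^ 4 * D 4) -
      ∑ ℓ : Fin 4 × Bool, (H 0 ℓ + t * H 1 ℓ + t ^ 2 * H 2 ℓ + t ^ 4 * H 4 ℓ) := by
  rw [Finset.sum_add_distrib, Finset.sum_add_distrib, Finset.sum_add_distrib, ← Finset.mul_sum,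
    ← Finset.mul_sum, ← Finset.mul_sum]
  ring

/-- A sum over labels is a sum over directions of the forward and backward terms. -/
theorem sum_label_eq_sum_dir {V : Type*} [AddCommMonoid V] (G : Fin 4 × Bool → V) :
    ∑ ℓ : Fin 4 × Bool, G ℓ = ∑ μ : Fin 4, (G (μ, false) + G (μ, true)) := by
  rw [Fintype.sum_prod_type]
  refine Finset.sum_congr rfl fun μ _ => ?_
  rw [Fintype.sum_bool, add_comm]

/-! ## Spin factors -/

/-- `½ (1 - γ_μ)` entrywise is the forward projector. -/
theorem half_one_sub_gamma_apply (μ : Fin 4) (α β : Fin 4) :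
    (1 / 2 : ℂ) * ((((1 : ℝ) : ℂ) • (1 : Matrix (Fin 4) (Fin 4) ℂ) - euclideanGamma μ) α β) =
      (chiralProjMinus μ) α β := by
  simp [chiralProjMinus, Matrix.sub_apply, Matrix.smul_apply]

/-- `½ (1 + γ_μ)` entrywise is the backward projector. -/
theorem half_one_add_gamma_apply (μ : Fin 4) (α β : Fin 4) :
    (1 / 2 : ℂ) * ((((1 : ℝ) : ℂ) • (1 : Matrix (Fin 4) (Fin 4) ℂ) + euclideanGamma μ) α β) =
      (chiralProjPlus μ) α β := by
  simp [chiralProjPlus, Matrix.add_apply, Matrix.smul_apply]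

/-! ## Colour factors -/

/-- Row scaling times the twisted link: `t^{EXPF c (a e)}` on the diagonal. -/
theorem rowScale_mul_link {t : ℂ} (ht : ‖t‖ = 1) (g : Matrix.specialUnitaryGroup (Fin 3) ℂ)
    (hg : (g : Matrix (Fin 3) (Fin 3) ℂ) = Matrix.diagonal ![conj t, conj t, t ^ 2]) (n : ℤ) (c c' : Fin 3) :
    (if c = (2 : Fin 3) then t ^ 2 else t) *
        (((if n = 1 then g else if n = -1 then g⁻¹ else 1 : Matrix.specialUnitaryGroup (Fin 3) ℂ) :
          Matrix (Fin 3) (Fin 3) ℂ) c c') =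
      if c = c' then t ^ (EXPF c n) else 0 := by
  have hrow : (if c = (2 : Fin 3) then t ^ 2 else t) = ![t, t, t ^ 2] c := by
    fin_cases c <;> simp
  rw [hrow]
  by_cases h1 : n = 1
  · subst h1
    simp only [if_true, hg, rowScale_mul_diag ht]
    by_cases hcc : c = c'
    · simp only [hcc, if_true]
      fin_cases c' <;> simp
    · simp [hcc]
  · by_cases h2 : n = -1
    · subst h2
      have h : ((if (-1 : ℤ) = 1 then g else if (-1 : ℤ) = -1 then g⁻¹ else 1 :
          Matrix.specialUnitaryGroup (Fin 3) ℂ) : Matrix (Fin 3) (Fin 3) ℂ) =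
          Matrix.diagonal ![t, t, conj t ^ 2] := by
        rw [if_neg (by decide), if_pos rfl, coe_inv_su3_diag g hg]
      rw [h, rowScale_mul_diag_inv ht]
      by_cases hcc : c = c'
      · simp only [hcc, if_true]
        fin_cases c' <;> simp
      · simp [hcc]
    · have h : ((if n = 1 then g else if n = -1 then g⁻¹ else 1 :
          Matrix.specialUnitaryGroup (Fin 3) ℂ) : Matrix (Fin 3) (Fin 3) ℂ) = 1 := by
        rw [if_neg h1, if_neg h2]; rfl
      rw [h, rowScale_mul_one t]
      by_cases hcc : c = c'
      · simp only [hcc, if_true]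
        fin_cases c' <;> simp [h1, h2]
      · simp [hcc]

/-- Row scaling times the inverse twisted link: `t^{EXPF c (-a e)}` on the diagonal. -/
theorem rowScale_mul_link_inv {t : ℂ} (ht : ‖t‖ = 1) (g : Matrix.specialUnitaryGroup (Fin 3) ℂ)
    (hg : (g : Matrix (Fin 3) (Fin 3) ℂ) = Matrix.diagonal ![conj t, conj t, t ^ 2]) (n : ℤ) (c c' : Fin 3) :
    (if c = (2 : Fin 3) then t ^ 2 else t) *
        ((((if n = 1 then g else if n = -1 then g⁻¹ else 1 : Matrix.specialUnitaryGroup (Fin 3) ℂ)⁻¹ :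
          Matrix.specialUnitaryGroup (Fin 3) ℂ) : Matrix (Fin 3) (Fin 3) ℂ) c c') =
      if c = c' then t ^ (EXPF c (-n)) else 0 := by
  have key : ((if n = 1 then g else if n = -1 then g⁻¹ else 1 : Matrix.specialUnitaryGroup (Fin 3) ℂ)⁻¹) =
      (if (-n) = 1 then g else if (-n) = -1 then g⁻¹ else 1) := by
    by_cases h1 : n = 1
    · subst h1; simp
    · by_cases h2 : n = -1
      · subst h2; simp
      · have h3 : ¬(-n = 1) := fun h => h2 (by omega)
        have h4 : ¬(-n = -1) := fun h => h1 (by omega)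
        rw [if_neg h1, if_neg h2, if_neg h3, if_neg h4, inv_one]
  rw [key]
  exact rowScale_mul_link ht g hg (-n) c c'

/-! ## Entries of the one-flavour Wilson matrix -/

/-- The entries of `wilsonD U m₀` (the tree's `wilsonDirac` at `r = 1`, fundamental `SU(3)`). -/
theorem wilsonD_apply {N : ℕ} [NeZero N]
    (U : GaugeConfig 4 N (Matrix.specialUnitaryGroup (Fin 3) ℂ)) (m₀ : ℝ) (p q : QIdx N) :
    wilsonD U m₀ p q =
      (if p = q then ((m₀ + 4 * 1 : ℝ) : ℂ) else 0) -
        (1 / 2 : ℂ) * ∑ μ : Fin 4,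
          ((if q.1 = Site.shift p.1 μ then
              (((1 : ℝ) : ℂ) • (1 : Matrix (Fin 4) (Fin 4) ℂ) - euclideanGamma μ) p.2.2 q.2.2 *
                ((U (p.1, μ) : Matrix.specialUnitaryGroup (Fin 3) ℂ) : Matrix (Fin 3) (Fin 3) ℂ) p.2.1 q.2.1
            else 0) +
            (if p.1 = Site.shift q.1 μ then
              (((1 : ℝ) : ℂ) • (1 : Matrix (Fin 4) (Fin 4) ℂ) + euclideanGamma μ) p.2.2 q.2.2 *
                (((U (q.1, μ))⁻¹ : Matrix.specialUnitaryGroup (Fin 3) ℂ) : Matrix (Fin 3) (Fin 3) ℂ) p.2.1 q.2.1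
            else 0)) := by
  rfl

/-! ## The entry identity -/

/-- **The row-scaled twisted side matrix is a polynomial matrix in the twist** (registered
`c1_sideWitness_aux4`). -/
theorem rowScaled_sideMatrix_eq {N : ℕ} [NeZero N] (A : Finset (TorusSite 4 N)) (m₀ : ℝ)
    (a : TorusSite 4 N → Fin 4 → ℤ) {t : ℂ} (ht : ‖t‖ = 1) (g : Matrix.specialUnitaryGroup (Fin 3) ℂ)
    (hg : (g : Matrix (Fin 3) (Fin 3) ℂ) = Matrix.diagonal ![conj t, conj t, t ^ 2]) :
    Matrix.diagonal (fun p : QIdx N => if p.1 ∈ A then (if p.2.1 = (2 : Fin 3) then t ^ 2 else t) else 1) *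
        sideMatrix A (wilsonD (fun ed => if a ed.1 ed.2 = 1 then g else if a ed.1 ed.2 = -1 then g⁻¹ else 1) m₀) =
      (FLOWMAT A a m₀ 0) + t • (FLOWMAT A a m₀ 1) + t ^ 2 • (FLOWMAT A a m₀ 2) + t ^ 4 • (FLOWMAT A a m₀ 4) := by
  ext p q
  rw [Matrix.diagonal_mul]
  simp only [Matrix.add_apply, Matrix.smul_apply, smul_eq_mul, Matrix.of_apply, sideMatrix]
  by_cases hA : p.1 ∈ A ∧ q.1 ∈ A
  · rw [if_pos hA, if_pos hA, if_pos hA, if_pos hA, if_pos hA, if_pos hA.1]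
    have key := poly_regroup t
      (fun k : ℕ => (if p = q ∧ (if p.2.1 = (2 : Fin 3) then (2 : ℕ) else 1) = k then (((m₀ : ℝ) + 4 : ℝ) : ℂ) else 0))
      (fun (k : ℕ) (ℓ : Fin 4 × Bool) => (if q.1 = p.1 + STEP ℓ ∧ p.2.1 = q.2.1 ∧ EXPF p.2.1 (LEXP a p.1 ℓ) = k
        then (PROJ ℓ) p.2.2 q.2.2 else 0))
    rw [key]
    rw [wilsonD_apply, mul_sub, Finset.mul_sum, Finset.mul_sum, sum_label_eq_sum_dir]
    congr 1
    · -- the mass term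
      by_cases hpq : p = q
      · subst hpq
        by_cases hc : p.2.1 = (2 : Fin 3) <;> simp [hc]
      · simp [hpq]
    · refine Finset.sum_congr rfl fun μ _ => ?_
      rw [mul_add, mul_add, ← mul_assoc, ← mul_assoc]
      congr 1
      · -- forward hop `q = p + e_μ`
        by_cases hf : q.1 = Site.shift p.1 μ
        · have hf' : q.1 = p.1 + STEP ((μ, false) : Fin 4 × Bool) := by
            rw [hf, shift_eq_add_step]
          rw [if_pos hf]
          have hcol := rowScale_mul_link ht g hg (a p.1 μ) p.2.1 q.2.1
          have hval : (if p.2.1 = (2 : Fin 3) then t ^ 2 else t) * (1 / 2) *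
              (((((1 : ℝ) : ℂ) • (1 : Matrix (Fin 4) (Fin 4) ℂ) - euclideanGamma μ) p.2.2 q.2.2) *
                (((if a p.1 μ = 1 then g else if a p.1 μ = -1 then g⁻¹ else 1 :
                  Matrix.specialUnitaryGroup (Fin 3) ℂ) : Matrix (Fin 3) (Fin 3) ℂ) p.2.1 q.2.1)) =
              (if p.2.1 = q.2.1 then t ^ (EXPF p.2.1 (a p.1 μ)) else 0) * (chiralProjMinus μ) p.2.2 q.2.2 := by
            rw [← half_one_sub_gamma_apply, ← hcol]; ring
          rw [hval]
          by_cases hcc : p.2.1 = q.2.1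
          · rw [if_pos hcc]
            have hsel : ∀ k : ℕ, (if q.1 = p.1 + STEP ((μ, false) : Fin 4 × Bool) ∧ p.2.1 = q.2.1 ∧
                (EXPF p.2.1 (LEXP a p.1 ((μ, false) : Fin 4 × Bool))) = k
                then (PROJ ((μ, false) : Fin 4 × Bool)) p.2.2 q.2.2 else 0) =
                (if (EXPF p.2.1 (a p.1 μ)) = k then (chiralProjMinus μ) p.2.2 q.2.2 else 0) := by
              intro k
              simp only [hf', hcc, true_and, Bool.false_eq_true, ite_false]
            rw [hsel 0, hsel 1, hsel 2, hsel 4, texp_collapse _ _ (expf_mem p.2.1 (a p.1 μ))]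
          · rw [if_neg hcc, zero_mul]
            have hsel : ∀ k : ℕ, (if q.1 = p.1 + STEP ((μ, false) : Fin 4 × Bool) ∧ p.2.1 = q.2.1 ∧
                (EXPF p.2.1 (LEXP a p.1 ((μ, false) : Fin 4 × Bool))) = k
                then (PROJ ((μ, false) : Fin 4 × Bool)) p.2.2 q.2.2 else 0) = 0 := by
              intro k
              rw [if_neg (fun h => hcc h.2.1)]
            rw [hsel 0, hsel 1, hsel 2, hsel 4]
            ring
        · have hf' : ¬(q.1 = p.1 + STEP ((μ, false) : Fin 4 × Bool)) := by
            rwa [← shift_eq_add_step]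
          rw [if_neg hf, mul_zero]
          have hsel : ∀ k : ℕ, (if q.1 = p.1 + STEP ((μ, false) : Fin 4 × Bool) ∧ p.2.1 = q.2.1 ∧
              (EXPF p.2.1 (LEXP a p.1 ((μ, false) : Fin 4 × Bool))) = k
              then (PROJ ((μ, false) : Fin 4 × Bool)) p.2.2 q.2.2 else 0) = 0 := by
            intro k
            rw [if_neg (fun h => hf' h.1)]
          rw [hsel 0, hsel 1, hsel 2, hsel 4]
          ring
      · -- backward hop `p = q + e_μ`
        by_cases hb : p.1 = Site.shift q.1 μ
        · have hb' : q.1 = p.1 + STEP ((μ, true) : Fin 4 × Bool) := (eq_shift_iff_eq_add_step p.1 q.1 μ).1 hb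
          rw [if_pos hb]
          have hcol := rowScale_mul_link_inv ht g hg (a q.1 μ) p.2.1 q.2.1
          have hval : (if p.2.1 = (2 : Fin 3) then t ^ 2 else t) * (1 / 2) *
              (((((1 : ℝ) : ℂ) • (1 : Matrix (Fin 4) (Fin 4) ℂ) + euclideanGamma μ) p.2.2 q.2.2) *
                ((((if a q.1 μ = 1 then g else if a q.1 μ = -1 then g⁻¹ else 1 :
                  Matrix.specialUnitaryGroup (Fin 3) ℂ)⁻¹ : Matrix.specialUnitaryGroup (Fin 3) ℂ) :
                    Matrix (Fin 3) (Fin 3) ℂ) p.2.1 q.2.1)) =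
              (if p.2.1 = q.2.1 then t ^ (EXPF p.2.1 (-(a q.1 μ))) else 0) * (chiralProjPlus μ) p.2.2 q.2.2 := by
            rw [← half_one_add_gamma_apply, ← hcol]; ring
          rw [hval]
          have hq : p.1 + STEP ((μ, true) : Fin 4 × Bool) = q.1 := hb'.symm
          by_cases hcc : p.2.1 = q.2.1
          · rw [if_pos hcc]
            have hsel : ∀ k : ℕ, (if q.1 = p.1 + STEP ((μ, true) : Fin 4 × Bool) ∧ p.2.1 = q.2.1 ∧
                (EXPF p.2.1 (LEXP a p.1 ((μ, true) : Fin 4 × Bool))) = k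
                then (PROJ ((μ, true) : Fin 4 × Bool)) p.2.2 q.2.2 else 0) =
                (if (EXPF p.2.1 (-(a q.1 μ))) = k then (chiralProjPlus μ) p.2.2 q.2.2 else 0) := by
              intro k
              simp only [hb', hcc, true_and, ite_true]
            rw [hsel 0, hsel 1, hsel 2, hsel 4, texp_collapse _ _ (expf_mem p.2.1 (-(a q.1 μ)))]
          · rw [if_neg hcc, zero_mul]
            have hsel : ∀ k : ℕ, (if q.1 = p.1 + STEP ((μ, true) : Fin 4 × Bool) ∧ p.2.1 = q.2.1 ∧
                (EXPF p.2.1 (LEXP a p.1 ((μ, true) : Fin 4 × Bool))) = k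
                then (PROJ ((μ, true) : Fin 4 × Bool)) p.2.2 q.2.2 else 0) = 0 := by
              intro k
              rw [if_neg (fun h => hcc h.2.1)]
            rw [hsel 0, hsel 1, hsel 2, hsel 4]
            ring
        · have hb' : ¬(q.1 = p.1 + STEP ((μ, true) : Fin 4 × Bool)) := fun h =>
            hb ((eq_shift_iff_eq_add_step p.1 q.1 μ).2 h)
          rw [if_neg hb, mul_zero]
          have hsel : ∀ k : ℕ, (if q.1 = p.1 + STEP ((μ, true) : Fin 4 × Bool) ∧ p.2.1 = q.2.1 ∧
              (EXPF p.2.1 (LEXP a p.1 ((μ, true) : Fin 4 × Bool))) = k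
              then (PROJ ((μ, true) : Fin 4 × Bool)) p.2.2 q.2.2 else 0) = 0 := by
            intro k
            rw [if_neg (fun h => hb' h.1)]
          rw [hsel 0, hsel 1, hsel 2, hsel 4]
          ring
  · -- off the `A × A` block: the identity
    rw [if_neg hA, if_neg hA, if_neg hA, if_neg hA, if_neg hA]
    by_cases hpq : p = q
    · subst hpq
      have hp : p.1 ∉ A := fun h => hA ⟨h, h⟩
      simp [hp]
    · simp [hpq]

/-- **Registered helper `c1_sideWitness_aux4` of crux stmt-QuantumFields-11512** (line `von-mises-circles`,
sub-goal `c1_sideWitness`): the colour factor of the row-scaled twisted hop (the file's main result is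
`rowScaled_sideMatrix_eq`). -/
theorem c1_sideWitness_aux4 : ∀ (t : ℂ), ‖t‖ = 1 → ∀ (g : Matrix.specialUnitaryGroup (Fin 3) ℂ), (g : Matrix (Fin 3) (Fin 3) ℂ) = Matrix.diagonal ![(starRingEnd ℂ) t, (starRingEnd ℂ) t, t ^ 2] → ∀ (n : ℤ) (c c' : Fin 3), (if c = (2 : Fin 3) then t ^ 2 else t) * (((if n = 1 then g else if n = -1 then g⁻¹ else 1 : Matrix.specialUnitaryGroup (Fin 3) ℂ) : Matrix (Fin 3) (Fin 3) ℂ) c c') = if c = c' then t ^ ((if n = (1 : ℤ) then (if c = (2 : Fin 3) then (4 : ℕ) else 0) else if n = (-1 : ℤ) then (if c = (2 : Fin 3) then (0 : ℕ) else 2) else (if c = (2 : Fin 3) then (2 : ℕ) else 1))) else 0 :=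
  fun _ ht g hg n c c' => rowScale_mul_link ht g hg n c c'

end Summit.QuantumFields.QCD.Theorems.VonMisesCirclesC1
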